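import Summits.Langlands.Langlands.Theorems.QuadraticWindowHostInducedRepAsaiGlobalFactorisation

/-!
# Asai poles of an automorphic induction in a biquadratic tower — stub `stub_asaiPoleInduced` of
line `one-transparent-pane`
(crux `Summit.Langlands.Langlands.Theses.QuadraticWindow.HostInducedRep`, item stmt-Langlands-10902)

LOG (landing worker, wave 3, 2026-08-16).  REGISTERED THEOREM of this file (textual form, hypotheses
inside the type): `theorem stub_asaiPoleInduced_cond : H₁ → H₂ → H₃ → <registered transfer statement
verbatim>` (skeleton lines 124–135; the conclusion plugs into the landed `stub_paneLaw_cond` as its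
`htransfer`).  The three hypotheses, in the least deprecated currency available (the deprecated named
fact `Mok2014_partialAsaiL_pole_dichotomy` is NOT referenced anywhere in the chain):
* `H₁` (`hsign`) — Mok's Asai-pole dichotomy in the TYPED (raw-product) currency of `HasAsaiPole`,
  reduced to the two pieces the proof uses: for every quadratic `E/F` (`c ≠ 1`) and every cuspidal `π`
  on `GL_N(𝔸_E)`, `N ≥ 1`, conjugate self-dual a.e., there is a sign `η` with `π.HasAsaiPole c η`
  (EXISTENCE of the pole sign) and, for every Asai datum, a FINITE raw limit of `L^S(s, π, As^{-η})`
  at `1⁺` (uniqueness half).  Status: NOT a published theorem as typed (the typed pole is a limit of the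
  raw partial Euler product on `{1 < Re s}`: Ramanujan-strength for `N ≥ 3`, tree
  `AsaiSignContinuation.lean`); strictly weaker than the deprecated raw rendering (no non-vanishing at
  `-η`); it follows from Mok's CORRECTED continuation statement + `H₃` (proved in the companion file
  `…AsaiPoleInducedCont`, `hsign_of_continuation`, whose registered `stub_asaiPoleInduced_cont` is this
  theorem with `H₁` replaced by the corrected, published, statement); it implies the pane law's `hex`.
* `H₂` (`hGS`) — Grbac–Shahidi 2015, Thm. 4.3 (1), (2)(a)–(b) at `s = 1` for PARTIAL Asai functions of
  a.e.-unitary cuspidal data, continuation form (a PUBLISHED fact, true as printed; stated here by its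
  body, which is verbatim the body of the named fact `GrbacShahidi2015_partialAsaiL_at_one` filed by the
  companion file `…AsaiPoleInducedFacts` for relocation to `Literature/…/AsaiSignContinuation.lean`, so
  that `hGS : GrbacShahidi2015_partialAsaiL_at_one` feeds `H₂` by `exact hGS`).
* `H₃` (`hhol`) — NOT a fact: the currency hypothesis of `AsaiSignContinuation.lean`, holomorphy of the
  RAW partial Asai Euler products on `{1 < Re s}` (Ramanujan-strength for rank `≥ 3`), here for every
  a.e.-unitary cuspidal datum (conjugate self-dual data are a.e.-unitary,
  `eventually_norm_prod_eq_one_of_isConjSelfDualAE`).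
WHICH DIRECTION NEEDS WHAT (`hasAsaiPole_induced_of_hasAsaiPole` / `hasAsaiPole_induced_iff`): the
direction `P.HasAsaiPole s ε → Q.HasAsaiPole cK ε` — the only one consumed by the pane law, at
`ε = -1` — uses `H₂`, `H₃` and `H₁` FOR `Q` ONLY (w.r.t. `K/F₀`); the converse uses in addition only
the EXISTENCE of a pole sign for `P` w.r.t. `L/F'` (no finiteness).  Neither needs anything Mok-like for
`P` w.r.t. the third subfield `F = L^{st}`: there Grbac–Shahidi (any `k ≤ 1`) suffices.
Chain (landing order, each ≤ 400 lines, fact-free; module prefix `QuadraticWindowHostInducedRep`):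
`AsaiLocalInduced` → `AsaiTowerPlaces` → `AsaiLocalIdentity` → `AsaiFibreProducts` → `AsaiLocalIdentityQ`
→ `AsaiGlobalFactorisation` → this file (→ companion A `AsaiPoleInducedCont`: the continuation-form
corollary `stub_asaiPoleInduced_cont`, fact-free; → companion B `AsaiPoleInducedFacts`: the named fact +
`exists_hasAsaiSign_of_hsign`).  Landed: AsaiLocalInduced p115698 · AsaiTowerPlaces p115887 ·
AsaiLocalIdentity p116404 · AsaiFibreProducts p116604 · AsaiLocalIdentityQ p116811 · AsaiGlobalFactorisation
p116974 (this file and the companions: see their LOGs / the lead's NOTES).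

## Statement

Tower: `K/F₀` quadratic (involution `cK`), `L/K` quadratic, `L/F'` quadratic with involution `s`
restricting to `cK` on `K`; so `L/F₀` is biquadratic, `Gal(L/F₀) = {1, t, s, st}` (`t` generating
`Gal(L/K)`), with the three quadratic subfields `K = L^t`, `F' = L^s`, `F = L^{st}`.  `P` cuspidal on
`GL_n(𝔸_L)` (`n ≥ 1`), `s`-conjugate self-dual a.e.; `Q` cuspidal on `GL_{2n}(𝔸_K)`, a weak automorphic
induction of `P`, `cK`-conjugate self-dual a.e.  CLAIM: for both signs `ε`,
`Q.HasAsaiPole cK ε ↔ P.HasAsaiPole s ε`.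

## Proof

1. *Local identity* (`local_factor_eq`, files 1–5): for a Satake family `A'` over `L` and the family
   `A` over `K` induced from it, at every place `v` of `F₀` unramified in the tower,
   `L_v(z, A, As^ε_{K/F₀}) = ∏_{v'|v} L_{v'}(z, A', As^ε_{L/F'}) ∏_{v''|v} L_{v''}(z, A', As^ε_{L/F})` — the
   Euler factor of `As_{K/F₀}(Ind_{L/K} ρ) ≅ Ind_{F'/F₀} As_{L/F'} ρ ⊕ Ind_{F/F₀} As_{L/F} ρ`, by the
   position of the decomposition group `D_v ∈ {1, ⟨t⟩, ⟨s⟩, ⟨st⟩}`.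
2. *Matched data and factorisation* (file 6): Flath + the induction relation give a finite `S₁` and
   Asai data `(S₁, A)` of `Q`, `(S₁', A')`, `(S₁'', A')` of `P` w.r.t. `F'`, `F`, with `A` induced from
   `A'` off `S₁`; whenever the two `P`-side raw products are multipliable at `z`,
   `L^{S₁}(z, Q, As^η) = L^{S₁'}(z, P, As^η_{L/F'}) · L^{S₁''}(z, P, As^η_{L/F})`.
3. *The clash* (`exists_clash_datum`): for NO sign `η` can `L^{S₁'}(z, P, As^η_{L/F'})` have a genuine
   simple pole at `1⁺` while `L^{S₁}(z, Q, As^η)` has a finite limit there.  Indeed `P`, `Q` are unitary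
   a.e.; `H₂` for `P` w.r.t. `(L/F, st)` gives `k ≤ 1`, `δ > 0` and a continuation `G` of
   `(z-1)^k L^{S₁''}(z, P, As^η_{L/F})`, holomorphic on `{1 < Re z} ∪ B(1, δ)`, `G(1) ≠ 0`, and (w.r.t.
   both `F` and `F'`) a far half-plane of multipliability; by `H₃` the three raw products are
   holomorphic on `{1 < Re z}`, so the factorisation extends from the far half-plane to `{1 < Re z}`
   (identity theorem) and `(z-1)^k L^{S₁''} → G(1)` as `z → 1⁺`; hence
   `(z-1)^{k+1} L^{S₁}(z, Q, As^η) → r_P G(1) ≠ 0`, whereas a finite limit of `L^{S₁}(Q, As^η)` forces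
   `(z-1)^{k+1} L^{S₁} → 0`.
4. *Signs.*  (←) If `P.HasAsaiPole s ε` and `η_Q` is the sign of `Q` (`H₁`): either `ε = η_Q`, done, or
   `ε = -η_Q`, and then `L^{S₁}(Q, As^ε)` is finite at `1⁺` — clash.  (→) If `Q.HasAsaiPole cK ε` and
   `η_P` is a pole sign of `P`: either `ε = η_P`, done, or `η_P = -ε`; the pole of `Q` at `ε` on `(S₁, A)`
   and the finiteness at `-η_Q` force `ε = η_Q` (`eq_of_hasAsaiPole_of_tendsto`), so `L^{S₁}(Q, As^{-ε})`
   is finite while `P` has its pole at `η_P = -ε` — clash.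
The field `F = L^{st}` is realised as `IntermediateField.fixedField`, and `F'` is made an `F₀`-algebra
inside the proof (`exists_ringHom_of_restricts`).

References: Grbac–Shahidi, Pacific J. Math. 276 (2015), Thm. 4.3 [GrbacShahidi2015]; Mok, Mem. AMS 235
(2015), §2.5, Thm. 2.5.4 (a) [Mok2014]; Arthur–Clozel, Ann. Math. Stud. 120, Ch. 3, (2.2)–(2.3),
Def. 6.1 [ArthurClozelAMS120]; Flicker, Bull. SMF 116 (1988) [Flicker1988]; Borel–Jacquet, Corvallis
1979, 5.7 [BorelJacquetCorvallis1979].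
-/

set_option linter.dupNamespace false -- project-wide option (lakefile weak.linter.dupNamespace); `Summit.Langlands.Langlands` is the mandated namespace

open scoped Classical Topology
open Literature.NumberTheory.Automorphic
open Summit.Langlands.Langlands.Theorems.HostInducedRep.Negative
open IsDedekindDomain NumberField Polynomial Filter

namespace Summit.Langlands.Langlands.Theorems.HostInducedRep.OneTransparentPane

section Tower

variable {F₀ K F' L : Type} [Field F₀] [NumberField F₀] [Field K] [NumberField K]
  [Field F'] [NumberField F'] [Field L] [NumberField L] [Algebra F₀ K] [Algebra K L] [Algebra F' L]
  {cK : K ≃ₐ[F₀] K} {s : L ≃ₐ[F'] L}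

variable
  /- `H₂`: Grbac–Shahidi 2015, Thm. 4.3 at `s = 1` for partial Asai functions (continuation form; the
  body of the named fact `GrbacShahidi2015_partialAsaiL_at_one` of `…AsaiPoleInducedFacts`). -/
  (hGS : ∀ (F E : Type) [Field F] [NumberField F] [Field E] [NumberField E] [Algebra F E] (c : E ≃ₐ[F] E),
    Module.finrank F E = 2 → c ≠ 1 →
    ∀ (N : ℕ) (hcpt : isCompact_glFiniteIntegralLevel N E) (π : CuspidalAutomorphicRepData N E hcpt),
      0 < N →
      (∀ᶠ w : HeightOneSpectrum (𝓞 E) in cofinite, ∀ α : Multiset ℂ,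
        π.1.HasSatakeParamAt w α → ‖α.prod‖ = 1) →
      ∀ (S : Set (HeightOneSpectrum (𝓞 F))) (A : SatakeFamily E) (η : ℤˣ), π.1.IsAsaiDatum c S A →
        ∃ σ₀ : ℝ, 1 ≤ σ₀ ∧
          (∀ s : ℂ, σ₀ < s.re →
            Multipliable fun v : {v : HeightOneSpectrum (𝓞 F) // v ∉ S} =>
              ((asaiLocalPolynomial c A η (placeAbove E v.1)).eval ((v.1.residueCard : ℂ) ^ (-s)))⁻¹) ∧
          ∃ (k : ℕ) (δ : ℝ) (G : ℂ → ℂ), k ≤ 1 ∧ 0 < δ ∧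
            DifferentiableOn ℂ G ({s : ℂ | 1 < s.re} ∪ Metric.ball 1 δ) ∧
            (∀ s : ℂ, σ₀ < s.re → G s = (s - 1) ^ k * partialAsaiL S c A η s) ∧ G 1 ≠ 0)
  /- `H₃`: holomorphy of the raw partial Asai Euler products of a.e.-unitary cuspidal data on
  `{1 < Re s}` (the currency hypothesis of `AsaiSignContinuation.lean`). -/
  (hhol : ∀ (F E : Type) [Field F] [NumberField F] [Field E] [NumberField E] [Algebra F E]
    (c : E ≃ₐ[F] E), Module.finrank F E = 2 → c ≠ 1 →
    ∀ (N : ℕ) (hcpt : isCompact_glFiniteIntegralLevel N E) (π : CuspidalAutomorphicRepData N E hcpt),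
      0 < N →
      (∀ᶠ w : HeightOneSpectrum (𝓞 E) in cofinite, ∀ α : Multiset ℂ,
        π.1.HasSatakeParamAt w α → ‖α.prod‖ = 1) →
      ∀ (S : Set (HeightOneSpectrum (𝓞 F))) (A : SatakeFamily E) (θ : ℤˣ), π.1.IsAsaiDatum c S A →
        DifferentiableOn ℂ (partialAsaiL S c A θ) {s : ℂ | 1 < s.re})

include hGS hhol

/-- **The clash** (Step 3 of the module docstring).  In the tower of the stub, granted `H₂` and `H₃`,
there are Asai data `(S₁, A)` of `Q` w.r.t. `(K/F₀, cK)` and `(S₁', A')` of `P` w.r.t. `(L/F', s)`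
(matched: `S₁'` is the preimage of `S₁`, `A` is induced from `A'`) such that for no sign `η` the raw product `L^{S₁'}(z, P, As^η_{L/F'})` has a genuine simple
pole at `1⁺` while `L^{S₁}(z, Q, As^η)` has a finite limit there: the factorisation
`L^{S₁}(Q, As^η) = L^{S₁'}(P, As^η_{L/F'}) · L^{S₁''}(P, As^η_{L/F})` on `{1 < Re z}` and Grbac–Shahidi for
the third subfield `F = L^{st}` give `(z-1)^{k+1} L^{S₁}(Q, As^η) → r_P G(1) ≠ 0`.
[cite: GrbacShahidi2015, Thm. 4.3] [cite: ArthurClozelAMS120, Ch. 3 Def. 6.1] -/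
theorem exists_clash_datum (h2 : Module.finrank F₀ K = 2) (h2K : Module.finrank K L = 2)
    (h2F' : Module.finrank F' L = 2) (hcK : cK ≠ 1) (hs : s ≠ 1)
    (hsK : ∀ x : K, s (algebraMap K L x) = algebraMap K L (cK x))
    {n : ℕ} {hL : isCompact_glFiniteIntegralLevel n L} {hK : isCompact_glFiniteIntegralLevel (2 * n) K}
    (P : CuspidalAutomorphicRepData n L hL) (Q : CuspidalAutomorphicRepData (2 * n) K hK) (hn : 0 < n)
    (hAI : IsAutomorphicInductionAlong P.1 Q.1) (hP : P.1.IsConjSelfDualAE s)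
    (hQ : Q.1.IsConjSelfDualAE cK) :
    ∃ (S₁ : Set (HeightOneSpectrum (𝓞 F₀))) (A : SatakeFamily K) (S₁' : Set (HeightOneSpectrum (𝓞 F')))
      (A' : SatakeFamily L), Q.1.IsAsaiDatum cK S₁ A ∧ P.1.IsAsaiDatum s S₁' A' ∧
      ∀ η : ℤˣ,
        (∃ r : ℂ, r ≠ 0 ∧
          Tendsto (fun z => (z - 1) * partialAsaiL S₁' s A' η z) (𝓝[{z : ℂ | 1 < z.re}] 1) (𝓝 r)) →
        (∃ r' : ℂ, Tendsto (partialAsaiL S₁ cK A η) (𝓝[{z : ℂ | 1 < z.re}] 1) (𝓝 r')) → False := by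
  /- Step 0: `L` and `F'` as `F₀`-algebras, the involution `t`, and the field `F = L^{s₀ t₀}` -/
  letI algF₀L : Algebra F₀ L := ((algebraMap K L).comp (algebraMap F₀ K)).toAlgebra
  haveI : IsScalarTower F₀ K L := IsScalarTower.of_algebraMap_eq fun _ => rfl
  obtain ⟨φ, hφ⟩ := exists_ringHom_of_restricts h2F' hs hsK
  letI algF₀F' : Algebra F₀ F' := φ.toAlgebra
  haveI : IsScalarTower F₀ F' L := IsScalarTower.of_algebraMap_eq fun x => (hφ x).symm
  have h4 : Module.finrank F₀ L = 4 := by rw [← Module.finrank_mul_finrank F₀ K L, h2, h2K]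
  haveI : FiniteDimensional F₀ L := Module.finite_of_finrank_eq_succ h4
  haveI : Algebra.IsQuadraticExtension K L := { finrank_eq_two' := h2K }
  obtain ⟨t, ht⟩ := Literature.NumberTheory.QuadraticForms.QuadraticExtension.exists_algEquiv_ne_one
    (K := K) (E := L)
  have hsK' : ∀ x : K, s.restrictScalars F₀ (algebraMap K L x) = algebraMap K L (cK x) := hsK
  obtain ⟨-, -, -, hst1, htt, hcomm⟩ := klein_relations₀ h4 h2K hcK ht hsK'
  have hss : s.restrictScalars F₀ * s.restrictScalars F₀ = 1 := by
    rw [← AlgEquiv.restrictScalars_mul', AlgEquiv.mul_self_eq_one_of_finrank_eq_two h2F' s]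
    exact AlgEquiv.ext fun _ => rfl
  set g₀ : L ≃ₐ[F₀] L := s.restrictScalars F₀ * t.restrictScalars F₀ with hg₀
  have hg₀1 : g₀ ≠ 1 := hst1
  have hg₀2 : g₀ ^ 2 = 1 := by
    rw [sq, hg₀]
    calc s.restrictScalars F₀ * t.restrictScalars F₀ * (s.restrictScalars F₀ * t.restrictScalars F₀)
        = s.restrictScalars F₀ * (t.restrictScalars F₀ * s.restrictScalars F₀) * t.restrictScalars F₀ := by
          simp only [mul_assoc]
      _ = s.restrictScalars F₀ * (s.restrictScalars F₀ * t.restrictScalars F₀) * t.restrictScalars F₀ := by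
          rw [hcomm]
      _ = s.restrictScalars F₀ * s.restrictScalars F₀ * (t.restrictScalars F₀ * t.restrictScalars F₀) := by
          simp only [mul_assoc]
      _ = 1 := by rw [hss, htt, one_mul]
  let F : IntermediateField F₀ L := IntermediateField.fixedField (Subgroup.zpowers g₀)
  have hθfix : ∀ x : F, g₀ (x : L) = x := fun x =>
    (IntermediateField.mem_fixedField_iff (Subgroup.zpowers g₀) (x : L)).mp x.2 g₀ (Subgroup.mem_zpowers g₀)
  let θF : L ≃ₐ[F] L := { (g₀ : L ≃+* L) with commutes' := hθfix }
  have hθFapply : ∀ x : L, θF x = g₀ x := fun _ => rfl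
  have h2Fdeg : Module.finrank F L = 2 := by
    rw [IntermediateField.finrank_fixedField_eq_card, Nat.card_zpowers, orderOf_eq_prime hg₀2 hg₀1]
  have hθF1 : θF ≠ 1 := fun h => hg₀1 (AlgEquiv.ext fun x => by
    rw [← hθFapply, h]; rfl)
  have hθF₀ : θF.restrictScalars F₀ = s.restrictScalars F₀ * t.restrictScalars F₀ :=
    AlgEquiv.ext fun _ => rfl
  have h2n : 0 < 2 * n := by omega
  /- Step 2: matched Asai data; unitarity a.e. of `P` and `Q` -/
  obtain ⟨S₁, A, A', hQd, hPd', hPd'', gL, gK, gF', gF, hrel⟩ :=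
    exists_matched_data (F' := F') (F := F) h2 h2F' h2Fdeg hcK hs hθF1 P.1 Q.1 hAI
  have huP := eventually_norm_prod_eq_one_of_isConjSelfDualAE hn P hP
  have huQ := eventually_norm_prod_eq_one_of_isConjSelfDualAE h2n Q hQ
  refine ⟨S₁, A, _, A', hQd, hPd', fun η ⟨rP, hrP, hlimP⟩ ⟨rQ', hlimQ'⟩ => ?_⟩
  /- Step 3: Grbac–Shahidi for `P` w.r.t. `(L/F, θF)` and `(L/F', s)`, holomorphy of the raw products -/
  obtain ⟨σ₀, hσ₀, hmulF, k, δ, G, -, hδ, hGhol, hGeq, hG1⟩ :=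
    hGS F L θF h2Fdeg hθF1 n hL P hn huP _ A' η hPd''
  obtain ⟨σ₀', -, hmulF', -⟩ := hGS F' L s h2F' hs n hL P hn huP _ A' η hPd'
  have hholQ := hhol F₀ K cK h2 hcK (2 * n) hK Q h2n huQ S₁ A η hQd
  have hholF' := hhol F' L s h2F' hs n hL P hn huP _ A' η hPd'
  have hholF := hhol F L θF h2Fdeg hθF1 n hL P hn huP _ A' η hPd''
  -- the factorisation on the far half-plane …
  have hfar : ∀ z : ℂ, max σ₀ σ₀' < z.re →
      partialAsaiL S₁ cK A η z =
        partialAsaiL ((fun v' : HeightOneSpectrum (𝓞 F') => v'.under (𝓞 F₀)) ⁻¹' S₁) s A' η z *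
          partialAsaiL ((fun v'' : HeightOneSpectrum (𝓞 F) => v''.under (𝓞 F₀)) ⁻¹' S₁) θF A' η z :=
    fun z hz => partialAsaiL_induced_eq_mul h4 h2 h2K h2F' h2Fdeg hcK ht hs hθF1 hsK' hθF₀ gL gK gF' gF
      hrel η (hmulF' z (lt_of_le_of_lt (le_max_right _ _) hz))
      (hmulF z (lt_of_le_of_lt (le_max_left _ _) hz))
  -- … extends to `{1 < Re z}` by the identity theorem
  have hV : IsOpen {z : ℂ | 1 < z.re} := isOpen_lt continuous_const Complex.continuous_re
  set z₀ : ℂ := ((max σ₀ σ₀' + 1 : ℝ) : ℂ) with hz₀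
  have hz₀re : z₀.re = max σ₀ σ₀' + 1 := by simp [hz₀]
  have hσmax : 1 ≤ max σ₀ σ₀' := le_max_of_le_left hσ₀
  have hEq : Set.EqOn (partialAsaiL S₁ cK A η)
      (fun z => partialAsaiL ((fun v' : HeightOneSpectrum (𝓞 F') => v'.under (𝓞 F₀)) ⁻¹' S₁) s A' η z *
        partialAsaiL ((fun v'' : HeightOneSpectrum (𝓞 F) => v''.under (𝓞 F₀)) ⁻¹' S₁) θF A' η z)
      {z : ℂ | 1 < z.re} := by
    refine (hholQ.analyticOnNhd hV).eqOn_of_preconnected_of_eventuallyEq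
      ((hholF'.mul hholF).analyticOnNhd hV) (convex_halfSpace_re_gt 1).isPreconnected (z₀ := z₀) ?_ ?_
    · simp only [Set.mem_setOf_eq, hz₀re]; linarith
    · have hmem : {z : ℂ | max σ₀ σ₀' < z.re} ∈ 𝓝 z₀ :=
        (isOpen_lt continuous_const Complex.continuous_re).mem_nhds (by
          simp only [Set.mem_setOf_eq, hz₀re]; linarith)
      exact Filter.eventually_of_mem hmem fun z hz => hfar z hz
  -- limits as `z → 1⁺`
  have hlimF : Tendsto (fun z => (z - 1) ^ k *
      partialAsaiL ((fun v'' : HeightOneSpectrum (𝓞 F) => v''.under (𝓞 F₀)) ⁻¹' S₁) θF A' η z)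
      (𝓝[{z : ℂ | 1 < z.re}] 1) (𝓝 (G 1)) :=
    tendsto_nhdsWithin_of_continuation_ball hσ₀ hδ hGhol
      (((differentiableOn_id.sub_const 1).pow k).mul hholF) hGeq
  have hQlim : Tendsto (fun z => (z - 1) ^ (k + 1) * partialAsaiL S₁ cK A η z)
      (𝓝[{z : ℂ | 1 < z.re}] 1) (𝓝 (rP * G 1)) := by
    refine (hlimP.mul hlimF).congr' ?_
    filter_upwards [self_mem_nhdsWithin] with z hz
    rw [hEq hz]; ring
  have hQlim0 : Tendsto (fun z => (z - 1) ^ (k + 1) * partialAsaiL S₁ cK A η z)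
      (𝓝[{z : ℂ | 1 < z.re}] 1) (𝓝 0) := by
    have := ((tendsto_sub_one_nhdsWithin_one_lt_re).pow (k + 1)).mul hlimQ'
    rwa [zero_pow (Nat.succ_ne_zero k), zero_mul] at this
  exact mul_ne_zero hrP hG1 (tendsto_nhds_unique hQlim hQlim0)

/-- **Transfer of the pole from `P` to `Q`** (the direction consumed by the pane law): granted `H₂`,
`H₃` and Mok's dichotomy in the typed currency FOR `Q` ONLY (a sign `η_Q` with `Q.HasAsaiPole cK η_Q` and
finite raw limits of `L^S(Q, As^{-η_Q})` at `1⁺`), `P.HasAsaiPole s ε → Q.HasAsaiPole cK ε`: either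
`ε = η_Q`, or `ε = -η_Q` and the clash applies. [cite: Mok2014, Thm. 2.5.4 (a)]
[cite: GrbacShahidi2015, Thm. 4.3] -/
theorem hasAsaiPole_induced_of_hasAsaiPole (h2 : Module.finrank F₀ K = 2) (h2K : Module.finrank K L = 2)
    (h2F' : Module.finrank F' L = 2) (hcK : cK ≠ 1) (hs : s ≠ 1)
    (hsK : ∀ x : K, s (algebraMap K L x) = algebraMap K L (cK x))
    {n : ℕ} {hL : isCompact_glFiniteIntegralLevel n L} {hK : isCompact_glFiniteIntegralLevel (2 * n) K}
    (P : CuspidalAutomorphicRepData n L hL) (Q : CuspidalAutomorphicRepData (2 * n) K hK) (hn : 0 < n)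
    (hAI : IsAutomorphicInductionAlong P.1 Q.1) (hP : P.1.IsConjSelfDualAE s)
    (hQ : Q.1.IsConjSelfDualAE cK)
    (hsQ : ∃ ηQ : ℤˣ, Q.1.HasAsaiPole cK ηQ ∧
      ∀ (S : Set (HeightOneSpectrum (𝓞 F₀))) (A : SatakeFamily K), Q.1.IsAsaiDatum cK S A →
        ∃ r : ℂ, Tendsto (partialAsaiL S cK A (-ηQ)) (𝓝[{z : ℂ | 1 < z.re}] 1) (𝓝 r))
    {ε : ℤˣ} (hε : P.1.HasAsaiPole s ε) : Q.1.HasAsaiPole cK ε := by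
  obtain ⟨S₁, A, S₁', A', hQd, hPd', clash⟩ :=
    exists_clash_datum hGS hhol h2 h2K h2F' hcK hs hsK P Q hn hAI hP hQ
  obtain ⟨ηQ, hηQ, hfinQ⟩ := hsQ
  by_cases h : ε = ηQ
  · rw [h]; exact hηQ
  · exfalso
    refine clash ε (hε hPd') ?_
    rw [Int.units_ne_iff_eq_neg.mp h]
    exact hfinQ S₁ A hQd

/-- **The Asai pole transfer `Q.HasAsaiPole cK ε ↔ P.HasAsaiPole s ε`** for the specific tower, granted
`H₂`, `H₃`, Mok's dichotomy in the typed currency for `Q` (w.r.t. `K/F₀`) and the mere existence of a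
pole sign `η_P` of `P` (w.r.t. `L/F'`): (←) is `hasAsaiPole_induced_of_hasAsaiPole`; (→) if `ε ≠ η_P`
then `η_P = -ε`, the pole of `Q`
at `ε` on the matched datum forces `ε = η_Q` (`eq_of_hasAsaiPole_of_tendsto`), so `L^{S₁}(Q, As^{-ε})` is
finite at `1⁺` while `P` has its pole at `-ε` — clash. [cite: Mok2014, Thm. 2.5.4 (a)]
[cite: GrbacShahidi2015, Thm. 4.3] -/
theorem hasAsaiPole_induced_iff (h2 : Module.finrank F₀ K = 2) (h2K : Module.finrank K L = 2)
    (h2F' : Module.finrank F' L = 2) (hcK : cK ≠ 1) (hs : s ≠ 1)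
    (hsK : ∀ x : K, s (algebraMap K L x) = algebraMap K L (cK x))
    {n : ℕ} {hL : isCompact_glFiniteIntegralLevel n L} {hK : isCompact_glFiniteIntegralLevel (2 * n) K}
    (P : CuspidalAutomorphicRepData n L hL) (Q : CuspidalAutomorphicRepData (2 * n) K hK) (hn : 0 < n)
    (hAI : IsAutomorphicInductionAlong P.1 Q.1) (hP : P.1.IsConjSelfDualAE s)
    (hQ : Q.1.IsConjSelfDualAE cK)
    (hsP : ∃ ηP : ℤˣ, P.1.HasAsaiPole s ηP)
    (hsQ : ∃ ηQ : ℤˣ, Q.1.HasAsaiPole cK ηQ ∧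
      ∀ (S : Set (HeightOneSpectrum (𝓞 F₀))) (A : SatakeFamily K), Q.1.IsAsaiDatum cK S A →
        ∃ r : ℂ, Tendsto (partialAsaiL S cK A (-ηQ)) (𝓝[{z : ℂ | 1 < z.re}] 1) (𝓝 r))
    (ε : ℤˣ) : Q.1.HasAsaiPole cK ε ↔ P.1.HasAsaiPole s ε := by
  refine ⟨fun hε => ?_,
    hasAsaiPole_induced_of_hasAsaiPole hGS hhol h2 h2K h2F' hcK hs hsK P Q hn hAI hP hQ hsQ⟩
  obtain ⟨S₁, A, S₁', A', hQd, hPd', clash⟩ :=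
    exists_clash_datum hGS hhol h2 h2K h2F' hcK hs hsK P Q hn hAI hP hQ
  obtain ⟨ηP, hηP⟩ := hsP
  obtain ⟨ηQ, -, hfinQ⟩ := hsQ
  by_cases h : ε = ηP
  · rw [h]; exact hηP
  · exfalso
    have hηP' : ηP = -ε := by rw [Int.units_ne_iff_eq_neg.mp h, neg_neg]
    have hεQ : ε = ηQ := eq_of_hasAsaiPole_of_tendsto hQd hε (hfinQ S₁ A hQd)
    refine clash ηP (hηP hPd') ?_
    rw [hηP', hεQ]
    exact hfinQ S₁ A hQd

end Tower

/-! ### The registered stub (conditional form `H₁ → H₂ → H₃ → transfer`) -/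

/-- **Stub `stub_asaiPoleInduced` (conditional form).**  In the biquadratic tower `F₀ ⊆ K ⊆ L ⊇ F'`
(`[K:F₀] = [L:K] = [L:F'] = 2`, involutions `cK`, `s` with `s|_K = cK`), for `P` cuspidal on `GL_n(𝔸_L)`
(`n ≥ 1`), `s`-conjugate self-dual a.e., and `Q` cuspidal on `GL_{2n}(𝔸_K)`, a weak automorphic
induction of `P`, `cK`-conjugate self-dual a.e.: for both signs `ε`,
`Q.HasAsaiPole cK ε ↔ P.HasAsaiPole s ε` — GRANTED, in this order, `H₁`: Mok's Asai-pole dichotomy in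
the typed raw-product currency (existence of a sign `η` with `HasAsaiPole c η` and finite raw limits
of `L^S(As^{-η})` at `1⁺`, for every quadratic `E/F` and every conjugate self-dual cuspidal `π`; NOT a
published theorem as typed — Ramanujan-strength — but a consequence of Mok's corrected continuation
statement and `H₃`, `hsign_of_continuation` of `…AsaiPoleInducedCont`); `H₂`: Grbac–Shahidi 2015,
Thm. 4.3 at `s = 1` for partial Asai functions of a.e.-unitary cuspidal data, continuation form
(published; verbatim the body of the named fact `GrbacShahidi2015_partialAsaiL_at_one`); `H₃`: holomorphy
of the raw partial Asai Euler products of a.e.-unitary cuspidal data on `{1 < Re s}` (the currency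
hypothesis of `AsaiSignContinuation.lean`, Ramanujan-strength).  Proof: `hasAsaiPole_induced_iff` (module
docstring). [cite: GrbacShahidi2015, Thm. 4.3] [cite: Mok2014, Thm. 2.5.4 (a)]
[cite: ArthurClozelAMS120, Ch. 3 Def. 6.1] -/
theorem stub_asaiPoleInduced_cond :
    (∀ (F E : Type) [Field F] [NumberField F] [Field E] [NumberField E] [Algebra F E]
      (c : E ≃ₐ[F] E), Module.finrank F E = 2 → c ≠ 1 →
      ∀ (N : ℕ) (hcpt : isCompact_glFiniteIntegralLevel N E) (π : CuspidalAutomorphicRepData N E hcpt),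
        0 < N → π.1.IsConjSelfDualAE c →
        ∃ η : ℤˣ, π.1.HasAsaiPole c η ∧
          ∀ (S : Set (HeightOneSpectrum (𝓞 F))) (A : SatakeFamily E), π.1.IsAsaiDatum c S A →
            ∃ r : ℂ, Tendsto (partialAsaiL S c A (-η)) (𝓝[{s : ℂ | 1 < s.re}] 1) (𝓝 r)) →
    (∀ (F E : Type) [Field F] [NumberField F] [Field E] [NumberField E] [Algebra F E] (c : E ≃ₐ[F] E),
      Module.finrank F E = 2 → c ≠ 1 →
      ∀ (N : ℕ) (hcpt : isCompact_glFiniteIntegralLevel N E) (π : CuspidalAutomorphicRepData N E hcpt),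
        0 < N →
        (∀ᶠ w : HeightOneSpectrum (𝓞 E) in cofinite, ∀ α : Multiset ℂ,
          π.1.HasSatakeParamAt w α → ‖α.prod‖ = 1) →
        ∀ (S : Set (HeightOneSpectrum (𝓞 F))) (A : SatakeFamily E) (η : ℤˣ), π.1.IsAsaiDatum c S A →
          ∃ σ₀ : ℝ, 1 ≤ σ₀ ∧
            (∀ s : ℂ, σ₀ < s.re →
              Multipliable fun v : {v : HeightOneSpectrum (𝓞 F) // v ∉ S} =>
                ((asaiLocalPolynomial c A η (placeAbove E v.1)).eval ((v.1.residueCard : ℂ) ^ (-s)))⁻¹) ∧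
            ∃ (k : ℕ) (δ : ℝ) (G : ℂ → ℂ), k ≤ 1 ∧ 0 < δ ∧
              DifferentiableOn ℂ G ({s : ℂ | 1 < s.re} ∪ Metric.ball 1 δ) ∧
              (∀ s : ℂ, σ₀ < s.re → G s = (s - 1) ^ k * partialAsaiL S c A η s) ∧ G 1 ≠ 0) →
    (∀ (F E : Type) [Field F] [NumberField F] [Field E] [NumberField E] [Algebra F E]
      (c : E ≃ₐ[F] E), Module.finrank F E = 2 → c ≠ 1 →
      ∀ (N : ℕ) (hcpt : isCompact_glFiniteIntegralLevel N E) (π : CuspidalAutomorphicRepData N E hcpt),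
        0 < N →
        (∀ᶠ w : HeightOneSpectrum (𝓞 E) in cofinite, ∀ α : Multiset ℂ,
          π.1.HasSatakeParamAt w α → ‖α.prod‖ = 1) →
        ∀ (S : Set (HeightOneSpectrum (𝓞 F))) (A : SatakeFamily E) (θ : ℤˣ), π.1.IsAsaiDatum c S A →
          DifferentiableOn ℂ (partialAsaiL S c A θ) {s : ℂ | 1 < s.re}) →
    ∀ (F₀ K F' L : Type) [Field F₀] [NumberField F₀] [Field K] [NumberField K]
      [Field F'] [NumberField F'] [Field L] [NumberField L]
      [Algebra F₀ K] [Algebra K L] [Algebra F' L] (cK : K ≃ₐ[F₀] K) (s : L ≃ₐ[F'] L),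
      Module.finrank F₀ K = 2 → Module.finrank K L = 2 → Module.finrank F' L = 2 → cK ≠ 1 → s ≠ 1 →
      (∀ x : K, s (algebraMap K L x) = algebraMap K L (cK x)) →
    ∀ (n : ℕ) (hL : isCompact_glFiniteIntegralLevel n L)
      (hK : isCompact_glFiniteIntegralLevel (2 * n) K)
      (P : CuspidalAutomorphicRepData n L hL) (Q : CuspidalAutomorphicRepData (2 * n) K hK),
      0 < n → IsAutomorphicInductionAlong P.1 Q.1 → P.1.IsConjSelfDualAE s → Q.1.IsConjSelfDualAE cK →
      ∀ ε : ℤˣ, Q.1.HasAsaiPole cK ε ↔ P.1.HasAsaiPole s ε := by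
  intro hsign hGS hhol F₀ K F' L _ _ _ _ _ _ _ _ _ _ _ cK s h2 h2K h2F' hcK hs hsK n hL hK P Q hn hAI hP
    hQ ε
  exact hasAsaiPole_induced_iff hGS hhol h2 h2K h2F' hcK hs hsK P Q hn hAI hP hQ
    ((hsign F' L s h2F' hs n hL P hn hP).imp fun _ h => h.1)
    (hsign F₀ K cK h2 hcK (2 * n) hK Q (by omega) hQ) ε

end Summit.Langlands.Langlands.Theorems.HostInducedRep.OneTransparentPane
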